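import Summits.KontsevichZagierPeriods.KontsevichZagierPeriods.Statement
import Summits.KontsevichZagierPeriods.KontsevichZagierPeriods.Theses.TorsionLogs
import Literature.NumberTheory.Transcendental.KZKernelConjectureForms
import Literature.NumberTheory.Transcendental.KZProductIdeal
import Mathlib

/-!
# F4 ON-PATH — line `NeronHaar` on crux `TorsionSectorComplete` (stmt-KontsevichZagierPeriods-14212), fwd2-rung gen 20

`theorem onPath : KontsevichZagierPeriods → NeronTorsionHaar` — the summit implies the rung.  Member `false` (the floor) is a
theorem outright (`Theses.TorsionLogs.NeronTorsionPrimitiveChain_holds`); member `true` (the tied Haar sector statement) follows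
from Conjecture 1 in kernel form (`kzKernelConjecture_iff_isRational`): the element
`12•[r3O] + [rEta][rA][rA] − [π][rN] − c•([rA][rB])` evaluates (`KZ.eval_mul'`, `KZ.piRep_value`) to the value hypothesis.
No `sorry`.  Self-contained: verbatim copies of the three `def`s of `Lines/NeronHaar.lean` in the namespace `…NeronHaar.OnPath`;
the `@[simp]` hypothesis-form theorem is the shape the tribunal's forward probe `S → Rung` closes with. [cite: KontsevichZagier2001, §1.2]
-/

noncomputable section

open Set MeasureTheory
open Literature.NumberTheory.Transcendental
open Summit.KontsevichZagierPeriods.KontsevichZagierPeriods.Theses.TorsionLogs (NeronTorsionPrimitiveChain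
  NeronTorsionPrimitiveChain_holds TorsionSectorComplete)

set_option linter.dupNamespace false

namespace Summit.KontsevichZagierPeriods.KontsevichZagierPeriods.Cruxes.TorsionSectorComplete.NeronHaar.OnPath

/-- **Member `true`: the TIED HAAR SECTOR STATEMENT.**  For the floor's curve data verbatim (real cubic
`f = 4x³ − g₂x − g₃`, `g₂³ ≠ 27g₃²`, largest root `e₁ > 0`, `f > 0` beyond) and representations pinned as
`r3O = [e₁<z₂<z₁<z₀, z₂/(√f√f√f)]` (`= L₃(O)`), `rEta = [(e₁,∞), (g₂t+2g₃)/(2t²√f)]` (`= η₁`), `rA = [(e₁,∞), 1/√f]`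
(`= ω₁/2`), `rN = [{f < 0}, 1/√(−f)]` (`= Im ω₂`), `rB = [1<t<B, 1/t]` (`B > 1`), `[π] = KZ.piRep`, every integer `c`
satisfying the VALUE HYPOTHESIS gives an element of `KZ.relations`.
[cite: KontsevichZagier2001, §1.2] [cite: SilvermanATAEC1994, VI Thm 3.4, VI Thm 4.2] [cite: Lang1983, Ch. 13] -/
def NeronHaarSector : Prop :=
  ∀ (g₂ g₃ e₁ B : ℝ) (c : ℤ) (f : ℝ → ℝ),
    (∀ x, f x = 4 * x ^ 3 - g₂ * x - g₃) → g₂ ^ 3 - 27 * g₃ ^ 2 ≠ 0 → f e₁ = 0 → 0 < e₁ →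
    (∀ x, e₁ < x → 0 < f x) → 1 < B →
    ∀ (r3O : KZ.IntegralRep 3) (rEta rA rN rB : KZ.IntegralRep 1),
    r3O.domain = {z | e₁ < z 2 ∧ z 2 < z 1 ∧ z 1 < z 0} →
    Set.EqOn r3O.integrand
      (fun z => z 2 / (Real.sqrt (f (z 2)) * Real.sqrt (f (z 1)) * Real.sqrt (f (z 0)))) r3O.domain →
    rEta.domain = {t | e₁ < t 0} →
    Set.EqOn rEta.integrand (fun t => (g₂ * t 0 + 2 * g₃) / (2 * (t 0) ^ 2 * Real.sqrt (f (t 0)))) rEta.domain →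
    rA.domain = {t | e₁ < t 0} → Set.EqOn rA.integrand (fun t => (Real.sqrt (f (t 0)))⁻¹) rA.domain →
    rN.domain = {t | f (t 0) < 0} → Set.EqOn rN.integrand (fun t => (Real.sqrt (-f (t 0)))⁻¹) rN.domain →
    rB.domain = {t | 1 < t 0 ∧ t 0 < B} → Set.EqOn rB.integrand (fun t => (t 0)⁻¹) rB.domain →
    12 * r3O.value + rEta.value * rA.value * rA.value - Real.pi * rN.value - c * (rA.value * rB.value) = 0 →
    (12 : ℤ) • KZ.of r3O + KZ.of rEta * KZ.of rA * KZ.of rA - KZ.of KZ.piRep * KZ.of rN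
      - c • (KZ.of rA * KZ.of rB) ∈ KZ.relations

/-- **The family, indexed by the functional (`false` ↦ evaluation at a torsion point, `true` ↦ Haar measure).**
Member `false` is the floor decl `Theses.TorsionLogs.NeronTorsionPrimitiveChain` VERBATIM (the seed, CLOSED); member
`true` is `NeronHaarSector`. Honest containment: nothing else varies. -/
def NeronHaarMember : Bool → Prop
  | false => NeronTorsionPrimitiveChain
  | true => NeronHaarSector

/-- **THE RUNG `NeronTorsionHaar`: the torsion packets and their Haar limit.** -/
def NeronTorsionHaar : Prop := ∀ b : Bool, NeronHaarMember b


/-- The rung is the floor plus the new member. -/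
theorem rung_iff : NeronTorsionHaar ↔ NeronTorsionPrimitiveChain ∧ NeronHaarSector := by
  constructor
  · exact fun h => ⟨h false, h true⟩
  · rintro ⟨h₂, h₃⟩ (_ | _)
    · exact h₂
    · exact h₃

/-- **F4, new member:** Conjecture 1 (kernel form) gives the tied Haar statement. [cite: KontsevichZagier2001, §1.2] -/
@[simp] theorem haarSector_of_kontsevichZagierPeriods (h : _root_.KontsevichZagierPeriods) : NeronHaarSector := by
  have hK : KZKernelConjecture := kzKernelConjecture_iff_isRational.mpr h
  intro g₂ g₃ e₁ B c f _ _ _ _ _ _ r3O rEta rA rN rB _ _ _ _ _ _ _ _ _ _ hval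
  apply hK
  simp only [map_sub, map_add, map_zsmul, KZ.eval_mul', KZ.eval_of, KZ.piRep_value, zsmul_eq_mul]
  push_cast
  linear_combination hval

/-- **F4 ON-PATH LEMMA: the summit implies the rung.** -/
@[simp] theorem neronTorsionHaar_of_kontsevichZagierPeriods (h : _root_.KontsevichZagierPeriods) : NeronTorsionHaar :=
  rung_iff.mpr ⟨NeronTorsionPrimitiveChain_holds, haarSector_of_kontsevichZagierPeriods h⟩

/-- The literal shape `S → Rung`. -/
theorem onPath : _root_.KontsevichZagierPeriods → NeronTorsionHaar := neronTorsionHaar_of_kontsevichZagierPeriods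

/-- Name demanded by the forward brief: `<Rung>_of_<Summit>`. -/
theorem NeronTorsionHaar_of_KontsevichZagierPeriods : _root_.KontsevichZagierPeriods → NeronTorsionHaar := onPath

end Summit.KontsevichZagierPeriods.KontsevichZagierPeriods.Cruxes.TorsionSectorComplete.NeronHaar.OnPath

end
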